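import Mathlib.Analysis.SpecialFunctions.ImproperIntegrals
import Literature.NumberTheory.Transcendental.KZPeriods
import Literature.NumberTheory.Transcendental.KZCalculusProofs
import Literature.NumberTheory.Transcendental.KZProductIdeal
import Mathlib.Analysis.Calculus.Deriv.Polynomial
import Mathlib.Analysis.Calculus.Deriv.MeanValue
import Mathlib.FieldTheory.Separable
import Mathlib.FieldTheory.Minpoly.Field
import Mathlib.Algebra.Algebra.Hom.Rat
import HarnessLib

/-!
# Kontsevich–Zagier periods: discharged facts

Proofs of named facts stated in `Literature.NumberTheory.Transcendental.KZPeriods`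
(kept in this sibling file so that the definitions file stays untouched; statements are the
`def … : Prop` facts of that file, unchanged).

## Main statements

* `Literature.NumberTheory.Transcendental.isRealPeriod_pi_holds` — discharge of
  `isRealPeriod_pi`: `π` is a real (effective) Kontsevich–Zagier period.
* `Literature.NumberTheory.Transcendental.KZPeriods.isPeriod_pi_holds` — discharge of
  `KZPeriods.isPeriod_pi`: `(π : ℂ)` is a period.
* `Literature.NumberTheory.Transcendental.isRealPeriod_ratCast_holds`,
  `Literature.NumberTheory.Transcendental.isPeriod_ratCast_holds`,
  `Literature.NumberTheory.Transcendental.IsPeriod.one_holds` — discharges of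
  `isRealPeriod_ratCast`, `isPeriod_ratCast`, `IsPeriod.one`: `ℚ ⊆ P`, `1 ∈ P`.
* `Literature.NumberTheory.Transcendental.IsRealPeriod.add_holds`, `IsRealPeriod.sub_holds`,
  `IsRealPeriod.mul_holds`, `IsPeriod.add_holds`, `IsPeriod.mul_holds` — discharges of the
  closure facts `IsRealPeriod.add/sub/mul`, `IsPeriod.add/mul`: sums and products of periods are
  periods.
* `Literature.NumberTheory.Transcendental.exists_subring_coe_eq_periods_holds` — discharge of
  `exists_subring_coe_eq_periods`: the periods `P ⊆ ℂ` form a subring.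
* `Literature.NumberTheory.Transcendental.isRealPeriod_of_isAlgebraic_holds`,
  `Literature.NumberTheory.Transcendental.isPeriod_of_isAlgebraic_holds` — discharges of
  `isRealPeriod_of_isAlgebraic`, `isPeriod_of_isAlgebraic`: real algebraic numbers are real periods,
  `ℚ̄ ⊆ P`.

## Proofs

* `π`. Kontsevich–Zagier [2001, §1.1, eq. (1)] represent `π` as a period by any of
  `∬_{x² + y² ≤ 1} dx dy = 2 ∫_{-1}^{1} √(1 - x²) dx = ∫_{-1}^{1} dx / √(1 - x²) = ∫_{-∞}^{∞} dx / (1 + x²)`.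
  We use the last one: `n = 1`, `σ = ℝ¹` (the whole space, trivially `ℚ`-semialgebraic),
  `p = 1`, `q = 1 + x₀²` (non-vanishing on `ℝ¹`), together with Mathlib's `∫ x, (1 + x²)⁻¹ = π`
  (`integral_univ_inv_one_add_sq`) and its absolute convergence (`integrable_inv_one_add_sq`),
  transported along the measure-preserving equivalence `(Fin 1 → ℝ) ≃ᵐ ℝ`
  (`MeasureTheory.volume_preserving_funUnique`).
* `r ∈ ℚ`. `r = ∫_{0 ≤ x₀ ≤ 1} r dx₀` [Kontsevich–Zagier 2001, §1.1: "`P` … contains `ℚ`"]: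
  `n = 1`, `σ = {0 ≤ x₀} ∩ {x₀ ≤ 1}` (semialgebraic as an intersection of a non-negativity set
  and a non-strict inequality set), `p = C r`, `q = 1`; `vol σ = vol [0, 1] = 1` by the same
  transport.
* `P` is a ring. Kontsevich–Zagier [2001, §1.1, p. 5 of the IHÉS text]: "periods form an algebra,
  so we get new periods by taking sums and products of known ones" (no proof is printed; [§4.1,
  p. 31]: "the product of integrals is again an integral (Fubini formula)"). The proofs are taken
  from the tree's KZ calculus. *Sums*: by `KZ.isRealPeriod_iff_exists_integralRep_holds`
  (`KZCalculusProofs`, which uses the Tarski–Seidenberg theorem `tarski_seidenberg_real_holds`) a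
  real period is the value of an integral representation `(σ, f)`; two representations of
  dimensions `n`, `m` are merged into one of dimension `max n m + 1` by
  `KZ.IntegralRep.exists_of_add_of_sub_of_mem_relations` (raise both to the common dimension by
  unit slabs, place them at the disjoint levels `[0, 1]` and `[2, 3]` of one more coordinate, glue
  by domain additivity), and soundness of the moves `KZ.relations_le_ker_eval_holds` identifies
  the value of the merged representation with the sum. *Products*: the product representation
  `KZ.IntegralRep.prod` on `σ × τ ⊆ ℝⁿ⁺ᵐ` with integrand `f ⊗ g` has value `(∫_σ f) (∫_τ g)` by
  Fubini (`KZ.IntegralRep.value_prod`, `KZProductIdeal`). Complex periods: `(z w).re =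
  z.re w.re − z.im w.im`, `(z w).im = z.re w.im + z.im w.re`; with `IsPeriod.zero/neg` (definitions
  file) and `IsPeriod.one_holds` the carrier `periods` is a `Subring ℂ`.
* `ℚ̄ ⊆ P`. Kontsevich–Zagier [2001, §1.1, p. 3 of the IHÉS text] write `√2 = ∫_{2x² ≤ 1} dx` and
  [p. 4] list "the algebraic numbers" among the periods; no proof is printed. The proof here is by
  root isolation: a real algebraic `x > 0` is a simple root of `f = ± minpoly_ℚ x` (irreducible,
  hence separable in characteristic `0`), normalised so that `f'(x) > 0`; then `f' > 0` on a
  neighbourhood `(x - δ, x + δ)`, on which `f` is strictly increasing (mean value theorem), so for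
  rationals `max (x - δ, 0) < a < x < b < x + δ` the interval
  `(0, x) = (0, a] ∪ {t | a < t < b, f(t) < 0}` is a `ℚ`-semialgebraic subset of `ℝ¹` and
  `x = vol (0, x) = ∫_{(0, x)} 1` (`isRealPeriod_of_pos_of_aeval_eq_zero`); `x < 0` reduces to
  `-x` by `IsRealPeriod.neg`, and `0` is `IsRealPeriod.zero`. For `z ∈ ℚ̄ ⊆ ℂ`,
  `re z = (z + z̄)/2` and `im z = (z - z̄)/(2i)` are algebraic (`z̄` is the image of `z` under the
  `ℚ`-algebra map `conj`, and `i² + 1 = 0`), hence real periods (`isAlgebraic_re_im`).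

## References

* M. Kontsevich, D. Zagier, *Periods*, in: Mathematics Unlimited — 2001 and Beyond, Springer
  (2001), 771–808 (IHÉS preprint M/01/22), §1.1 and eq. (1) there.
-/

noncomputable section

open MvPolynomial Set
open _root_.MeasureTheory

namespace Literature.NumberTheory.Transcendental

/-! ### `π` is a period -/

/-- Discharge of `isRealPeriod_pi`: `π = ∫_{ℝ} dx / (1 + x²)` is a real period
(`n = 1`, `σ = ℝ¹`, `p = 1`, `q = 1 + x₀²`).
[Kontsevich–Zagier 2001, §1.1, eq. (1)] [cite: KontsevichZagier2001, §1.1 eq. (1)] -/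
theorem isRealPeriod_pi_holds : isRealPeriod_pi := by
  have hmp := MeasureTheory.volume_preserving_funUnique (Fin 1) ℝ
  -- the integrand: `p / q = (x ↦ (1 + x²)⁻¹) ∘ (y ↦ y 0)` on `ℝ¹ = (Fin 1 → ℝ)`
  have hfun : (fun y : Fin 1 → ℝ => aeval y (1 : MvPolynomial (Fin 1) ℚ) /
      aeval y (1 + X 0 ^ 2 : MvPolynomial (Fin 1) ℚ)) =
      (fun x : ℝ => (1 + x ^ 2)⁻¹) ∘ MeasurableEquiv.funUnique (Fin 1) ℝ := by
    funext y
    simp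
  refine ⟨1, univ, 1, 1 + X 0 ^ 2, Literature.ModelTheory.ExponentialFields.isSemialgebraic_univ,
    fun y _ => ?_, ?_, ?_⟩
  · -- `q = 1 + y₀² ≠ 0` on `σ = ℝ¹`
    have h : (0 : ℝ) < 1 + y 0 ^ 2 := by positivity
    simpa using h.ne'
  · -- absolute convergence, transported from `integrable_inv_one_add_sq`
    rw [integrableOn_univ, hfun]
    exact (hmp.integrable_comp_emb (MeasurableEquiv.measurableEmbedding _)).2
      integrable_inv_one_add_sq
  · -- the value, transported from `integral_univ_inv_one_add_sq`
    rw [Measure.restrict_univ, hfun]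
    exact ((hmp.integral_comp' fun x : ℝ => (1 + x ^ 2)⁻¹).trans integral_univ_inv_one_add_sq).symm

/-- Discharge of `KZPeriods.isPeriod_pi`: `π`, viewed as a complex number, is a Kontsevich–Zagier
period (its real part `π = ∫_{ℝ} dx / (1 + x²)` is a real period, its imaginary part `0` is one).
[Kontsevich–Zagier 2001, §1.1, eq. (1)] [cite: KontsevichZagier2001, §1.1 eq. (1)] -/
theorem KZPeriods.isPeriod_pi_holds : KZPeriods.isPeriod_pi :=
  isPeriod_ofReal_iff.2 isRealPeriod_pi_holds

/-! ### `ℚ ⊆ P` -/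

/-- Discharge of `isRealPeriod_ratCast`: every rational number `r = ∫_{0 ≤ x₀ ≤ 1} r dx₀` is a
real period (`n = 1`, `σ = [0, 1] ⊆ ℝ¹`, `p = C r`, `q = 1`).
[Kontsevich–Zagier 2001, §1.1] [cite: KontsevichZagier2001, §1.1] -/
theorem isRealPeriod_ratCast_holds : isRealPeriod_ratCast := by
  intro r
  have hmp := MeasureTheory.volume_preserving_funUnique (Fin 1) ℝ
  -- `σ = [0, 1] ⊆ ℝ¹`, realised inside `Fin 1 → ℝ` as the preimage of `Icc 0 1` under `y ↦ y 0`
  have hσ : Literature.ModelTheory.ExponentialFields.IsSemialgebraic ℚ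
      (MeasurableEquiv.funUnique (Fin 1) ℝ ⁻¹' Icc (0 : ℝ) 1) := by
    have hset : MeasurableEquiv.funUnique (Fin 1) ℝ ⁻¹' Icc (0 : ℝ) 1 =
        {x : Fin 1 → ℝ | 0 ≤ aeval x (X 0 : MvPolynomial (Fin 1) ℚ)} ∩
          {x | aeval x (X 0 : MvPolynomial (Fin 1) ℚ) ≤ aeval x (1 : MvPolynomial (Fin 1) ℚ)} := by
      ext y
      simp
    rw [hset]
    exact (Literature.ModelTheory.ExponentialFields.isSemialgebraic_setOf_eval_nonneg _).inter
      (Literature.ModelTheory.ExponentialFields.isSemialgebraic_setOf_eval_le _ _)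
  -- `vol σ = vol [0, 1] = 1`
  have hvol : volume (MeasurableEquiv.funUnique (Fin 1) ℝ ⁻¹' Icc (0 : ℝ) 1) = 1 := by
    have h : volume (MeasurableEquiv.funUnique (Fin 1) ℝ ⁻¹' Icc (0 : ℝ) 1) =
        volume (Icc (0 : ℝ) 1) :=
      hmp.measure_preimage_equiv _
    rw [h, Real.volume_Icc, sub_zero, ENNReal.ofReal_one]
  -- the integrand `p / q = r / 1` is the constant function `r`
  have hfun : (fun y : Fin 1 → ℝ => aeval y (C r : MvPolynomial (Fin 1) ℚ) /
      aeval y (1 : MvPolynomial (Fin 1) ℚ)) = fun _ => (r : ℝ) := by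
    funext y
    simp
  refine ⟨1, MeasurableEquiv.funUnique (Fin 1) ℝ ⁻¹' Icc (0 : ℝ) 1, C r, 1, hσ,
    fun y _ => by simp, ?_, ?_⟩
  · -- a constant is integrable on a set of finite measure
    rw [hfun]
    exact integrableOn_const (hvol.trans_ne ENNReal.one_ne_top)
  · -- `∫_σ r = vol σ • r = r`
    rw [hfun, setIntegral_const, measureReal_def, hvol, ENNReal.toReal_one, one_smul]

/-- Discharge of `isPeriod_ratCast`: every rational number is a period (its real part is a
real period by `isRealPeriod_ratCast_holds`, its imaginary part is `0`).
[Kontsevich–Zagier 2001, §1.1] [cite: KontsevichZagier2001, §1.1] -/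
theorem isPeriod_ratCast_holds : isPeriod_ratCast := by
  intro r
  rw [← Complex.ofReal_ratCast, isPeriod_ofReal_iff]
  exact isRealPeriod_ratCast_holds r

/-- Discharge of `IsPeriod.one`: `1 = (1 : ℚ)` is a period.
[Kontsevich–Zagier 2001, §1.1] [cite: KontsevichZagier2001, §1.1] -/
theorem IsPeriod.one_holds : IsPeriod.one := by
  change IsPeriod 1
  simpa using isPeriod_ratCast_holds 1

/-! ### `P` is a ring -/

/-- Discharge of `IsRealPeriod.add`: real periods are closed under addition. Both summands are
values of integral representations (`KZ.isRealPeriod_iff_exists_integralRep_holds`); these are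
merged into a single representation in dimension `max n m + 1` (slabs to the common dimension,
disjoint levels `[0, 1]` and `[2, 3]` of a new coordinate, glued by domain additivity:
`KZ.IntegralRep.exists_of_add_of_sub_of_mem_relations`), whose value is the sum by soundness of the
moves (`KZ.relations_le_ker_eval_holds`).
[Kontsevich–Zagier 2001, §1.1, p. 5: "periods form an algebra, so we get new periods by taking sums
and products of known ones"] [cite: KontsevichZagier2001, §1.1 p. 5] -/
theorem IsRealPeriod.add_holds : IsRealPeriod.add := by
  intro x y hx hy
  obtain ⟨n, r₁, rfl⟩ := KZ.isRealPeriod_iff_exists_integralRep_holds.mp hx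
  obtain ⟨m, r₂, rfl⟩ := KZ.isRealPeriod_iff_exists_integralRep_holds.mp hy
  obtain ⟨N, R, hR⟩ := r₁.exists_of_add_of_sub_of_mem_relations r₂
  have h := KZ.relations_le_ker_eval_holds hR
  rw [AddMonoidHom.mem_ker, map_sub, map_add, KZ.eval_of, KZ.eval_of, KZ.eval_of, sub_eq_zero] at h
  exact KZ.isRealPeriod_iff_exists_integralRep_holds.mpr ⟨N, R, h.symm⟩

/-- Discharge of `IsRealPeriod.sub`: real periods are closed under subtraction
(`x - y = x + (-y)`, from `IsRealPeriod.add_holds` and `IsRealPeriod.neg`).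
[Kontsevich–Zagier 2001, §1.1, p. 5] [cite: KontsevichZagier2001, §1.1 p. 5] -/
theorem IsRealPeriod.sub_holds : IsRealPeriod.sub := by
  intro x y hx hy
  simpa [sub_eq_add_neg] using IsRealPeriod.add_holds hx hy.neg

/-- Discharge of `IsRealPeriod.mul`: real periods are closed under multiplication. Both factors are
values of integral representations `(σ, f)`, `(τ, g)`; the product representation
`KZ.IntegralRep.prod` on `σ × τ ⊆ ℝⁿ⁺ᵐ` with integrand `f ⊗ g` (semialgebraic by Tarski–Seidenberg)
has value `(∫_σ f) · (∫_τ g)` by Fubini (`KZ.IntegralRep.value_prod`).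
[Kontsevich–Zagier 2001, §1.1, p. 5, and §4.1, p. 31: "the product of integrals is again an integral
(Fubini formula)"] [cite: KontsevichZagier2001, §1.1 p. 5] -/
theorem IsRealPeriod.mul_holds : IsRealPeriod.mul := by
  intro x y hx hy
  obtain ⟨n, r, rfl⟩ := KZ.isRealPeriod_iff_exists_integralRep_holds.mp hx
  obtain ⟨m, s, rfl⟩ := KZ.isRealPeriod_iff_exists_integralRep_holds.mp hy
  exact KZ.isRealPeriod_iff_exists_integralRep_holds.mpr ⟨n + m, r.prod s, r.value_prod s⟩

/-- Discharge of `IsPeriod.add`: periods are closed under addition (componentwise on real and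
imaginary parts, `IsRealPeriod.add_holds`).
[Kontsevich–Zagier 2001, §1.1, p. 5] [cite: KontsevichZagier2001, §1.1 p. 5] -/
theorem IsPeriod.add_holds : IsPeriod.add := by
  intro z w hz hw
  exact ⟨by simpa using IsRealPeriod.add_holds hz.1 hw.1,
    by simpa using IsRealPeriod.add_holds hz.2 hw.2⟩

/-- Discharge of `IsPeriod.mul`: periods are closed under multiplication:
`(z w).re = z.re w.re - z.im w.im`, `(z w).im = z.re w.im + z.im w.re` are real periods by
`IsRealPeriod.mul_holds`, `IsRealPeriod.sub_holds`, `IsRealPeriod.add_holds`.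
[Kontsevich–Zagier 2001, §1.1, p. 5] [cite: KontsevichZagier2001, §1.1 p. 5] -/
theorem IsPeriod.mul_holds : IsPeriod.mul := by
  intro z w hz hw
  exact ⟨by simpa [Complex.mul_re] using
      IsRealPeriod.sub_holds (IsRealPeriod.mul_holds hz.1 hw.1) (IsRealPeriod.mul_holds hz.2 hw.2),
    by simpa [Complex.mul_im] using
      IsRealPeriod.add_holds (IsRealPeriod.mul_holds hz.1 hw.2) (IsRealPeriod.mul_holds hz.2 hw.1)⟩

/-- Discharge of `exists_subring_coe_eq_periods`: **the Kontsevich–Zagier periods form a subring of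
`ℂ`** — the carrier `periods` is closed under `+` (`IsPeriod.add_holds`), `*`
(`IsPeriod.mul_holds`), `-` (`IsPeriod.neg`) and contains `0` (`IsPeriod.zero`) and `1`
(`IsPeriod.one_holds`).
[Kontsevich–Zagier 2001, §1.1, p. 5: "periods form an algebra, so we get new periods by taking sums
and products of known ones"] [cite: KontsevichZagier2001, §1.1 p. 5] -/
theorem exists_subring_coe_eq_periods_holds : exists_subring_coe_eq_periods :=
  ⟨{ carrier := periods
     mul_mem' := fun ha hb => IsPeriod.mul_holds ha hb
     one_mem' := IsPeriod.one_holds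
     add_mem' := fun ha hb => IsPeriod.add_holds ha hb
     zero_mem' := IsPeriod.zero
     neg_mem' := fun ha => IsPeriod.neg ha }, rfl⟩

/-! ### `ℚ̄ ⊆ P`: algebraic numbers are periods -/

/-- Root-isolation step. Let `f ∈ ℚ[X]` and let `x > 0` be a real root of `f` with `f'(x) > 0`.
Then `x` is a real period: on a neighbourhood of `x` the polynomial function `f` is strictly
increasing, so for rationals `a < x < b` in that neighbourhood (with `a > 0`) the open interval
`(0, x) = (0, a] ∪ {t | a < t < b, f(t) < 0}` is a `ℚ`-semialgebraic subset of `ℝ¹`, and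
`x = vol (0, x) = ∫_{(0, x)} 1`.
[Kontsevich–Zagier 2001, §1.1 (`√2 = ∫_{2x² ≤ 1} dx`)] [folklore] -/
theorem isRealPeriod_of_pos_of_aeval_eq_zero {x : ℝ} (hx : 0 < x) (f : Polynomial ℚ)
    (hf : Polynomial.aeval x f = 0) (hf' : 0 < Polynomial.aeval x (Polynomial.derivative f)) :
    IsRealPeriod x := by
  -- `f' > 0` on a neighbourhood `(x - δ, x + δ)` of `x`
  obtain ⟨δ, hδ, hpos⟩ : ∃ δ > 0, ∀ t : ℝ, dist t x < δ →
      0 < Polynomial.aeval t (Polynomial.derivative f) :=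
    Metric.eventually_nhds_iff.1
      ((Polynomial.differentiable_aeval (𝕜 := ℝ) (Polynomial.derivative f)).continuous
        |>.continuousAt.eventually (lt_mem_nhds hf'))
  -- hence `f` is strictly increasing there
  have hmono : StrictMonoOn (fun t : ℝ => Polynomial.aeval t f) (Ioo (x - δ) (x + δ)) := by
    refine strictMonoOn_of_deriv_pos (convex_Ioo _ _)
      (Polynomial.differentiable_aeval (𝕜 := ℝ) f).continuous.continuousOn fun t ht => ?_
    rw [interior_Ioo] at ht
    rw [(f.hasDerivAt_aeval t).deriv]
    exact hpos t (by rw [Real.dist_eq, abs_sub_lt_iff]; constructor <;> linarith [ht.1, ht.2])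
  -- rationals `max (x - δ) 0 < a < x < b < x + δ`
  obtain ⟨a, ha₁, ha₂⟩ := exists_rat_btwn (max_lt (sub_lt_self x hδ) hx)
  obtain ⟨b, hb₁, hb₂⟩ := exists_rat_btwn (lt_add_of_pos_right x hδ)
  have ha0 : (0 : ℝ) < a := (le_max_right _ _).trans_lt ha₁
  have haδ : x - δ < a := (le_max_left _ _).trans_lt ha₁
  have hx_mem : x ∈ Ioo (x - δ) (x + δ) := ⟨sub_lt_self x hδ, lt_add_of_pos_right x hδ⟩
  -- `f` as a polynomial in the variable `x₀` of `ℝ¹`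
  let F : MvPolynomial (Fin 1) ℚ := Polynomial.aeval (X 0) f
  have hF : ∀ y : Fin 1 → ℝ, aeval y F = Polynomial.aeval (y 0) f := fun y => by
    simp only [F, ← Polynomial.aeval_algHom_apply, aeval_X]
  -- the domain `σ = (0, x) ⊆ ℝ¹` and its semialgebraic description
  let σ : Set (Fin 1 → ℝ) := {y | 0 < y 0 ∧ y 0 < x}
  have hσ_eq : σ =
      ({y | 0 < aeval y (X 0 : MvPolynomial (Fin 1) ℚ)} ∩
          {y | aeval y (X 0 : MvPolynomial (Fin 1) ℚ) ≤ aeval y (C a : MvPolynomial (Fin 1) ℚ)}) ∪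
        ({y | aeval y (C a : MvPolynomial (Fin 1) ℚ) < aeval y (X 0 : MvPolynomial (Fin 1) ℚ)} ∩
            {y | aeval y (X 0 : MvPolynomial (Fin 1) ℚ) < aeval y (C b : MvPolynomial (Fin 1) ℚ)} ∩
          {y | aeval y F < aeval y (0 : MvPolynomial (Fin 1) ℚ)}) := by
    ext y
    simp only [σ, mem_setOf_eq, mem_union, mem_inter_iff, aeval_X, aeval_C, eq_ratCast, hF,
      map_zero]
    constructor
    · rintro ⟨h0, hyx⟩
      rcases le_or_gt (y 0) a with hya | hya
      · exact Or.inl ⟨h0, hya⟩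
      · refine Or.inr ⟨⟨hya, hyx.trans hb₁⟩, ?_⟩
        have h : Polynomial.aeval (y 0) f < Polynomial.aeval x f :=
          hmono ⟨haδ.trans hya, hyx.trans hx_mem.2⟩ hx_mem hyx
        rwa [hf] at h
    · rintro (⟨h0, hya⟩ | ⟨⟨hya, hyb⟩, hneg⟩)
      · exact ⟨h0, hya.trans_lt ha₂⟩
      · refine ⟨ha0.trans hya, ?_⟩
        by_contra hle
        have h : Polynomial.aeval x f ≤ Polynomial.aeval (y 0) f :=
          hmono.monotoneOn hx_mem ⟨haδ.trans hya, hyb.trans hb₂⟩ (not_lt.1 hle)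
        rw [hf] at h
        exact (not_lt.2 h) hneg
  have hσ : Literature.ModelTheory.ExponentialFields.IsSemialgebraic ℚ σ := by
    rw [hσ_eq]
    exact ((Literature.ModelTheory.ExponentialFields.isSemialgebraic_setOf_eval_pos _).inter
      (Literature.ModelTheory.ExponentialFields.isSemialgebraic_setOf_eval_le _ _)).union
      (((Literature.ModelTheory.ExponentialFields.isSemialgebraic_setOf_eval_lt _ _).inter
        (Literature.ModelTheory.ExponentialFields.isSemialgebraic_setOf_eval_lt _ _)).inter
        (Literature.ModelTheory.ExponentialFields.isSemialgebraic_setOf_eval_lt _ _))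
  -- `vol σ = vol (0, x) = x`
  have hmp := MeasureTheory.volume_preserving_funUnique (Fin 1) ℝ
  have hσ_pre : σ = MeasurableEquiv.funUnique (Fin 1) ℝ ⁻¹' Ioo 0 x := by
    ext y
    simp [σ, MeasurableEquiv.funUnique, Fin.default_eq_zero]
  have hvol : volume σ = ENNReal.ofReal x := by
    have h : volume (MeasurableEquiv.funUnique (Fin 1) ℝ ⁻¹' Ioo (0 : ℝ) x) =
        volume (Ioo (0 : ℝ) x) :=
      hmp.measure_preimage_equiv _
    rw [hσ_pre, h, Real.volume_Ioo, sub_zero]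
  -- the integrand `p / q = 1 / 1` is the constant function `1`
  have hfun : (fun y : Fin 1 → ℝ => aeval y (1 : MvPolynomial (Fin 1) ℚ) /
      aeval y (1 : MvPolynomial (Fin 1) ℚ)) = fun _ => (1 : ℝ) := by
    funext y
    simp
  refine ⟨1, σ, 1, 1, hσ, fun y _ => by simp, ?_, ?_⟩
  · rw [hfun]
    exact integrableOn_const (by rw [hvol]; exact ENNReal.ofReal_ne_top)
  · rw [hfun, setIntegral_const, measureReal_def, hvol, ENNReal.toReal_ofReal hx.le, smul_eq_mul,
      mul_one]

/-- Every positive real algebraic number is a real period: apply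
`isRealPeriod_of_pos_of_aeval_eq_zero` to `± minpoly_ℚ x`, which is separable (characteristic
`0`), so that `x` is a simple root and the sign can be chosen with `f'(x) > 0`.
[Kontsevich–Zagier 2001, §1.1] [folklore] -/
theorem isRealPeriod_of_pos_of_isAlgebraic {x : ℝ} (hx : 0 < x) (halg : IsAlgebraic ℚ x) :
    IsRealPeriod x := by
  have hint : IsIntegral ℚ x := halg.isIntegral
  have hf0 : Polynomial.aeval x (minpoly ℚ x) = 0 := minpoly.aeval ℚ x
  have hsep : (minpoly ℚ x).Separable := (minpoly.irreducible hint).separable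
  have hd : Polynomial.aeval x (Polynomial.derivative (minpoly ℚ x)) ≠ 0 :=
    hsep.aeval_derivative_ne_zero hf0
  rcases lt_or_gt_of_ne hd with hlt | hgt
  · exact isRealPeriod_of_pos_of_aeval_eq_zero hx (-minpoly ℚ x) (by simp [hf0])
      (by simpa [Polynomial.derivative_neg] using hlt)
  · exact isRealPeriod_of_pos_of_aeval_eq_zero hx (minpoly ℚ x) hf0 hgt

/-- Discharge of `isRealPeriod_of_isAlgebraic`: **every real algebraic number is a real period**
(`x > 0`: `isRealPeriod_of_pos_of_isAlgebraic`; `x = 0`: `IsRealPeriod.zero`; `x < 0`: `-x` is a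
positive real algebraic number and real periods are closed under negation, `IsRealPeriod.neg`).
[Kontsevich–Zagier 2001, §1.1: "`√2 = ∫_{2x² ≤ 1} dx`", "there are many examples of periods besides
`π` and the algebraic numbers"] [cite: KontsevichZagier2001, §1.1] -/
theorem isRealPeriod_of_isAlgebraic_holds : isRealPeriod_of_isAlgebraic := by
  intro x hx
  rcases lt_trichotomy x 0 with hneg | rfl | hpos
  · simpa using (isRealPeriod_of_pos_of_isAlgebraic (neg_pos.2 hneg) hx.neg).neg
  · exact IsRealPeriod.zero
  · exact isRealPeriod_of_pos_of_isAlgebraic hpos hx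

/-- The real and imaginary parts of a complex number algebraic over `ℚ` are algebraic over `ℚ`:
`re z = (z + z̄)/2`, `im z = (z - z̄)/(2i)` with `z̄` algebraic (complex conjugation is a
`ℚ`-algebra map) and `i` algebraic (`i² + 1 = 0`). [folklore] -/
theorem isAlgebraic_re_im {z : ℂ} (hz : IsAlgebraic ℚ z) :
    IsAlgebraic ℚ z.re ∧ IsAlgebraic ℚ z.im := by
  have hconj : IsAlgebraic ℚ (starRingEnd ℂ z) :=
    hz.algHom ((starRingEnd ℂ : ℂ →+* ℂ).toRatAlgHom)
  have hI : IsAlgebraic ℚ Complex.I := by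
    refine ⟨Polynomial.X ^ 2 + 1, Polynomial.Monic.ne_zero (by monicity!), ?_⟩
    simp
  have h2 : IsAlgebraic ℚ (2 : ℂ)⁻¹ := (isAlgebraic_nat 2).inv
  have hre : IsAlgebraic ℚ (z.re : ℂ) := by
    rw [Complex.re_eq_add_conj, div_eq_mul_inv]
    exact (hz.add hconj).mul h2
  have him : IsAlgebraic ℚ (z.im : ℂ) := by
    rw [Complex.im_eq_sub_conj, div_eq_mul_inv, mul_inv]
    exact (hz.sub hconj).mul (h2.mul hI.inv)
  exact ⟨(isAlgebraic_algebraMap_iff (A := ℂ) Complex.ofReal_injective).mp hre,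
    (isAlgebraic_algebraMap_iff (A := ℂ) Complex.ofReal_injective).mp him⟩

/-- Discharge of `isPeriod_of_isAlgebraic`: **`ℚ̄ ⊆ P`** — every complex number algebraic over `ℚ`
is a Kontsevich–Zagier period: its real and imaginary parts are real algebraic numbers
(`isAlgebraic_re_im`), hence real periods (`isRealPeriod_of_isAlgebraic_holds`).
[Kontsevich–Zagier 2001, §1.1: the Definition and "`√2 = ∫_{2x² ≤ 1} dx`"; p. 4 of the IHÉS
text: "there are many examples of periods besides `π` and the algebraic numbers"]
[cite: KontsevichZagier2001, §1.1] -/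
theorem isPeriod_of_isAlgebraic_holds : isPeriod_of_isAlgebraic := by
  intro z hz
  obtain ⟨hre, him⟩ := isAlgebraic_re_im hz
  exact ⟨isRealPeriod_of_isAlgebraic_holds hre, isRealPeriod_of_isAlgebraic_holds him⟩

end Literature.NumberTheory.Transcendental
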